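import Literature.AlgebraicGeometry.Resolution.KrullRamificationGroups
import Literature.AlgebraicGeometry.Resolution.ValuationRingsApproximation
import Literature.AlgebraicGeometry.Resolution.ValuationConjugation
import Literature.AlgebraicGeometry.Resolution.TameTowerInertiaUnramified
import Mathlib.Algebra.Polynomial.GroupRingAction
import Mathlib.Algebra.Module.Submodule.Union
import Mathlib.FieldTheory.Galois.Basic
import Mathlib.FieldTheory.Finite.Basic
import Mathlib.Algebra.Polynomial.Expand
import Mathlib.Algebra.Ring.Action.Subobjects
import HarnessLib

/-!
# Henselian generators of the decomposition and inertia fields of a Krull valuation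

Topic: `Literature/AlgebraicGeometry/Resolution` (valued function fields), continuing
`KrullRamificationGroups.lean` (Zariski–Samuel VI §12: the groups `G_Z ⊇ G_T ⊇ G_V` of a
valuation `V ∩ N` in a finite Galois extension `N | M` inside an ambient valued field
`(Ω, V)`). The decomposition field `M^Z = N^{G_Z}` and the inertia field `Mⁱ = N^{G_T}` are
generated by HENSELIAN ELEMENTS (F.-V. Kuhlmann; Knaf–Kuhlmann 2005 §5, 2009 Lemma 3.7 (3):
"`O_P|O_L` is local-étale if and only if `(F,P)` lies in the absolute inertia field of
`(L,P)`"): `M^Z = M(η)` and `Mⁱ = M^Z(η′)` with `η, η′ ∈ V` roots of monic polynomials `F, F′`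
with coefficients in `V ∩ M`, resp. `V ∩ M^Z`, such that `F'(η)`, `F′'(η′)` are units of `V`.
This is the valuation-theoretic input of the unramified ascent `(LU v₀) ⇒ (LU v₀ⁱ)` in
Cossart–Piltant 2019, Prop. 4.10 ([CoP1] Cor. 7.3), see
`ArithmeticalThreefoldsLocalEtaleClimb.lean`.

* `exists_henselRoot_adjoin_eq_decompositionField` — PROVED: `N^{G_Z} = M(η)` for a henselian
  element `η` over `V ∩ M`. Construction (classical, e.g. Nagata's proof that the
  decomposition field embeds in the henselization): by weak approximation in the finitely many,
  pairwise incomparable conjugates `σ • (V ∩ N)` (`ValuationRingsApproximation.lean`) pick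
  `e ∈ N` in all of them, `≡ 1` modulo the maximal ideal of `V ∩ N` and in the maximal ideal of
  every other conjugate; `η := ∏_{τ ∈ G_Z} τ e` is fixed by `G_Z`, `≡ 1 (mod 𝔪_V)`, and
  `σ η ∈ 𝔪_V` for `σ ∉ G_Z`; so the stabilizer of `η` is `G_Z`, and
  `F := ∏_{σ ∈ G/G_Z} (X − σ η)` has coefficients in `V ∩ M` and `F'(η) = ∏_{σ ≠ 1} (η − σ η)`
  a unit.
* `exists_henselRoot_adjoin_eq_inertiaField` — PROVED: `N^{G_T} = N^{G_Z}(η′)` for a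
  henselian element `η′` over `V ∩ N^{G_Z}`: an element `y ∈ V ∩ N` whose residue is moved by
  every `σ ∈ G_Z ∖ G_T` exists because the residue field `Nv` is not the union of the finitely
  many proper subfields fixed by these `σ` (a vector space over an infinite field is not a
  finite union of proper subspaces, Mathlib; over a finite residue field `Nv` is finite and a
  generator of `Nvˣ` works); a suitable coefficient of `∏_{τ ∈ G_T} (X − τ y)` is an
  `η′ ∈ V ∩ N^{G_T}` with residue `−m ȳ^{qᵃ}` (`|G_T| = qᵃ m`, `q` the residue characteristic
  exponent), still moved by every `σ ∈ G_Z ∖ G_T`; conclude as before inside `N | N^{G_Z}`.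

Everything is PROVED; no named facts are introduced.

## Sources

* O. Zariski, P. Samuel, *Commutative Algebra* II (1960), Ch. VI §12. [ZariskiSamuel1960]
* H. Knaf, F.-V. Kuhlmann, Adv. Math. 221 (2009), Lemma 3.7; Ann. Sci. ÉNS 38 (2005), §5.
* M. Nagata, *Local rings* (1962), §43–44 (henselization via decomposition rings). [folklore]
-/

noncomputable section

open Module IntermediateField IsLocalRing Polynomial
open scoped Pointwise

namespace Literature.AlgebraicGeometry.Resolution

universe u

/-! ### Valuative helpers -/

section Helpers

variable {K : Type u} [Field K]

/-- `v_A(x) < 1 ↔ x = 0 ∨ x⁻¹ ∉ A`. [folklore] -/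
theorem valuationSubring_valuation_lt_one_iff (A : _root_.ValuationSubring K) (x : K) :
    A.valuation x < 1 ↔ x = 0 ∨ x⁻¹ ∉ A := by
  by_cases hx : x = 0
  · subst hx
    simp
  · rw [← not_le, Valuation.one_le_val_iff _ hx, A.valuation_le_one_iff]
    simp [hx]

/-- `v(a − b) = 1` when `v(a − 1) < 1` and `v(b) < 1`. [folklore] -/
theorem valuation_sub_eq_one_of_sub_one_lt_of_lt (A : _root_.ValuationSubring K) {a b : K}
    (ha : A.valuation (a - 1) < 1) (hb : A.valuation b < 1) : A.valuation (a - b) = 1 := by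
  apply ValuationSubring.valuation_eq_one_of_sub_one A
  have heq : a - b - 1 = (a - 1) + -b := by ring
  rw [heq]
  refine Valuation.map_add_lt _ ha ?_
  rwa [Valuation.map_neg]

end Helpers

/-! ### The decomposition field is generated by a henselian element -/

section DecompositionField

variable {Ω : Type u} [Field Ω] (V : ValuationSubring Ω) {M : Subfield Ω}
  (N : IntermediateField M Ω)

/-- `v_{V ∩ N}(x) < 1 ↔ v(x) < 1` for `x ∈ N`. [folklore] -/
theorem valuation_comap_intermediateField_lt_one_iff (x : N) :
    (V.comap (algebraMap N Ω)).valuation x < 1 ↔ V.valuation (x : Ω) < 1 := by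
  rw [valuationSubring_valuation_lt_one_iff, valuationSubring_valuation_lt_one_iff,
    _root_.ValuationSubring.mem_comap, map_inv₀]
  have h0 : x = 0 ↔ (x : Ω) = 0 := by
    constructor
    · rintro rfl; rfl
    · intro h; exact_mod_cast h
  rw [h0]
  rfl

/-- `σ ∈ G_Z` iff `σ` fixes the valuation ring `V ∩ N` of `N` (as a conjugate).
[cite: ZariskiSamuel1960, Ch. VI §12, p. 68] -/
theorem mem_decompositionGroupIn_iff_smul_eq (σ : N ≃ₐ[M] N) :
    σ ∈ decompositionGroupIn V N ↔
      σ • V.comap (algebraMap N Ω) = V.comap (algebraMap N Ω) := by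
  rw [mem_decompositionGroupIn_iff]
  constructor
  · intro h
    ext x
    rw [_root_.ValuationSubring.mem_pointwise_smul_iff_inv_smul_mem,
      _root_.ValuationSubring.mem_comap, _root_.ValuationSubring.mem_comap, AlgEquiv.smul_def]
    have hx := h (σ⁻¹ x)
    rw [show σ (σ⁻¹ x) = x from AlgEquiv.apply_symm_apply σ x] at hx
    exact hx
  · intro h x
    have hx : σ x ∈ σ • V.comap (algebraMap N Ω) ↔ σ x ∈ V.comap (algebraMap N Ω) := by rw [h]
    rw [← AlgEquiv.smul_def, _root_.ValuationSubring.smul_mem_pointwise_smul_iff] at hx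
    exact hx

/-- **The decomposition field of a valuation in a finite Galois extension is generated by a
henselian element**: there is `η ∈ V ∩ N` fixed exactly by `G_Z`, root of a monic `F` with
coefficients in `V ∩ M` and `F'(η)` a unit of `V`, and `N^{G_Z} = M(η)`.
[cite: ZariskiSamuel1960, Ch. VI §12 (decomposition group and field); folklore (Nagata, *Local rings*, §43–44)] -/
theorem exists_henselRoot_adjoin_eq_decompositionField [FiniteDimensional M N] [IsGalois M N] :
    ∃ η : N, (η : Ω) ∈ V ∧ (∀ σ : N ≃ₐ[M] N, σ η = η ↔ σ ∈ decompositionGroupIn V N) ∧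
      (∃ F : Polynomial Ω, F.Monic ∧ (∀ k, F.coeff k ∈ V ∧ F.coeff k ∈ M) ∧
        F.eval (η : Ω) = 0 ∧ V.valuation ((derivative F).eval (η : Ω)) = 1) ∧
      fixedField (decompositionGroupIn V N) = IntermediateField.adjoin M ({η} : Set N) := by
  classical
  let O : _root_.ValuationSubring N := V.comap (algebraMap N Ω)
  have hOv : ∀ x : N, O.valuation x < 1 ↔ V.valuation (x : Ω) < 1 :=
    valuation_comap_intermediateField_lt_one_iff V N
  let Z : Subgroup (N ≃ₐ[M] N) := decompositionGroupIn V N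
  -- the finitely many, pairwise incomparable conjugates of `O`
  let ι : Type u := ↥(Set.range (fun σ : N ≃ₐ[M] N => σ • O))
  haveI : Finite ι := (Set.finite_range _).to_subtype
  let R : ι → _root_.ValuationSubring N := fun i => i.1
  have hR : ∀ i j, R i ≤ R j → i = j := by
    rintro ⟨_, σ, rfl⟩ ⟨_, τ, rfl⟩ hle
    apply Subtype.ext
    refine ValuationSubring.eq_of_le_of_comap_eq (F := M) hle ?_
    rw [comap_smul_algEquiv, comap_smul_algEquiv]
  let j₀ : ι := ⟨O, 1, one_smul _ _⟩
  obtain ⟨e, heR, he1, helt⟩ := ValuationSubring.exists_crt_of_forall_le_imp_eq R hR j₀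
  -- (a) all conjugates of `e` lie in `V`
  have ha : ∀ σ : N ≃ₐ[M] N, ((σ e : N) : Ω) ∈ V := fun σ => by
    have h := heR ⟨σ⁻¹ • O, σ⁻¹, rfl⟩
    change e ∈ σ⁻¹ • O at h
    rw [_root_.ValuationSubring.mem_inv_pointwise_smul_iff, AlgEquiv.smul_def] at h
    exact h
  -- (b) `σ e ∈ 𝔪_V` for `σ ∉ G_Z`
  have hb : ∀ σ : N ≃ₐ[M] N, σ ∉ Z → V.valuation ((σ e : N) : Ω) < 1 := fun σ hσ => by
    have hne : (⟨σ⁻¹ • O, σ⁻¹, rfl⟩ : ι) ≠ j₀ := by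
      intro h
      have h' : σ⁻¹ • O = O := congrArg (fun i : ι => (i.1 : _root_.ValuationSubring N)) h
      apply hσ
      have hinv : σ⁻¹ ∈ Z := (mem_decompositionGroupIn_iff_smul_eq V N σ⁻¹).mpr h'
      simpa using Z.inv_mem hinv
    have h := helt _ hne
    change (σ⁻¹ • O).valuation e < 1 at h
    rw [valuation_smul_lt_one_iff, inv_inv, AlgEquiv.smul_def, hOv] at h
    exact h
  -- (c) `τ e ≡ 1 (mod 𝔪_V)` for `τ ∈ G_Z`
  have hc : ∀ τ : N ≃ₐ[M] N, τ ∈ Z → V.valuation (((τ e : N) : Ω) - 1) < 1 := fun τ hτ => by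
    have h1 : V.valuation (((e - 1 : N)) : Ω) < 1 := by
      rw [← hOv]
      exact he1
    have h2 := (valuation_lt_one_iff_of_mem_decompositionGroupIn V N hτ (e - 1)).mp h1
    rw [map_sub, map_one] at h2
    push_cast at h2
    exact h2
  -- `η := ∏_{τ ∈ G_Z} τ e`
  haveI : Fintype ↥Z := Fintype.ofFinite _
  let η : N := ∏ τ : ↥Z, (τ : N ≃ₐ[M] N) e
  have hconj : ∀ σ : N ≃ₐ[M] N, σ η = ∏ τ : ↥Z, ((σ * (τ : N ≃ₐ[M] N)) e : N) := fun σ => by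
    change σ (∏ τ : ↥Z, (τ : N ≃ₐ[M] N) e) = _
    rw [map_prod]
    exact Finset.prod_congr rfl fun τ _ => (AlgEquiv.mul_apply σ (τ : N ≃ₐ[M] N) e).symm
  -- (d) `η` is fixed by `G_Z`
  have hd : ∀ τ : N ≃ₐ[M] N, τ ∈ Z → τ η = η := fun τ hτ => by
    rw [hconj]
    change ∏ σ : ↥Z, ((τ * (σ : N ≃ₐ[M] N)) e : N) = ∏ σ : ↥Z, ((σ : N ≃ₐ[M] N) e : N)
    exact Fintype.prod_equiv (Equiv.mulLeft (⟨τ, hτ⟩ : ↥Z))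
      (fun σ : ↥Z => ((τ * (σ : N ≃ₐ[M] N)) e : N)) (fun σ : ↥Z => ((σ : N ≃ₐ[M] N) e : N))
      (fun σ => rfl)
  -- (e) `η ≡ 1 (mod 𝔪_V)`
  have he : V.valuation ((η : Ω) - 1) < 1 := by
    change V.valuation (((∏ τ : ↥Z, (τ : N ≃ₐ[M] N) e : N) : Ω) - 1) < 1
    push_cast
    exact valuation_prod_sub_one_lt_one V _ _ fun τ _ => hc τ τ.2
  -- (f) `σ η ∈ 𝔪_V` for `σ ∉ G_Z`; (g) all conjugates of `η` lie in `V`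
  have hg : ∀ σ : N ≃ₐ[M] N, ((σ η : N) : Ω) ∈ V := fun σ => by
    rw [hconj]
    push_cast
    exact prod_mem fun τ _ => ha _
  have hf : ∀ σ : N ≃ₐ[M] N, σ ∉ Z → V.valuation ((σ η : N) : Ω) < 1 := fun σ hσ => by
    rw [hconj]
    push_cast
    refine ValuationSubring.valuation_prod_lt_one V Finset.univ _ (fun τ _ => ?_)
      (Finset.mem_univ (1 : ↥Z)) ?_
    · exact (V.valuation_le_one_iff _).mpr (ha _)
    · have h1 : ((1 : ↥Z) : N ≃ₐ[M] N) = 1 := rfl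
      rw [h1, mul_one]
      exact hb σ hσ
  have hηV : (η : Ω) ∈ V := by
    have h := hg 1
    rwa [AlgEquiv.one_apply] at h
  have hvη : V.valuation (η : Ω) = 1 := ValuationSubring.valuation_eq_one_of_sub_one V he
  -- the stabilizer of `η` is `G_Z`
  have hstab : ∀ σ : N ≃ₐ[M] N, σ η = η ↔ σ ∈ Z := fun σ =>
    ⟨fun h => by
      by_contra hσ
      have h1 := hf σ hσ
      rw [h, hvη] at h1
      exact lt_irrefl _ h1, hd σ⟩
  have hstab' : MulAction.stabilizer (N ≃ₐ[M] N) η = Z := by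
    ext σ
    rw [MulAction.mem_stabilizer_iff, AlgEquiv.smul_def, hstab]
  -- the polynomial `F = ∏_{σ ∈ G/G_Z} (X − σ η)` (cf. Mathlib's `prodXSubSMul`)
  haveI : Fintype (N ≃ₐ[M] N) := Fintype.ofFinite _
  let FN : N[X] := ∏ q : (N ≃ₐ[M] N) ⧸ MulAction.stabilizer (N ≃ₐ[M] N) η,
      (X - C (MulAction.ofQuotientStabilizer (N ≃ₐ[M] N) η q))
  have hFN : FN = ∏ q : (N ≃ₐ[M] N) ⧸ MulAction.stabilizer (N ≃ₐ[M] N) η,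
      (X - C (MulAction.ofQuotientStabilizer (N ≃ₐ[M] N) η q)) := rfl
  have hFNsmul : ∀ g : N ≃ₐ[M] N, g • FN = FN := fun g => by
    rw [hFN, Finset.smul_prod']
    exact Fintype.prod_bijective _ (MulAction.bijective g) _ _ fun q => by
      rw [MulAction.ofQuotientStabilizer_smul, smul_sub, Polynomial.smul_X, Polynomial.smul_C]
  have hFNmonic : FN.Monic := monic_prod_of_monic _ _ fun _ _ => monic_X_sub_C _
  have hFNeval : FN.eval η = 0 := by
    rw [hFN, eval_prod]
    refine Finset.prod_eq_zero
      (Finset.mem_univ (QuotientGroup.mk 1 : (N ≃ₐ[M] N) ⧸ MulAction.stabilizer (N ≃ₐ[M] N) η)) ?_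
    rw [MulAction.ofQuotientStabilizer_mk, one_smul, eval_sub, eval_X, eval_C, sub_self]
  -- its factors have roots in `V`
  have hroots : ∀ q : (N ≃ₐ[M] N) ⧸ MulAction.stabilizer (N ≃ₐ[M] N) η,
      ((MulAction.ofQuotientStabilizer (N ≃ₐ[M] N) η q : N) : Ω) ∈ V := by
    intro q
    obtain ⟨g, rfl⟩ := QuotientGroup.mk_surjective q
    rw [MulAction.ofQuotientStabilizer_mk, AlgEquiv.smul_def]
    exact hg g
  have hcoeffV : ∀ k, ((FN.coeff k : N) : Ω) ∈ V := by
    -- `FN` lifts to `O[X]`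
    have hlift : FN ∈ Polynomial.lifts (O.subtype : O →+* N) := by
      rw [hFN]
      refine Subsemiring.prod_mem _ fun q _ => ?_
      have hq : (-(MulAction.ofQuotientStabilizer (N ≃ₐ[M] N) η q) : N) ∈ O :=
        O.neg_mem _ (hroots q)
      have : X - C (MulAction.ofQuotientStabilizer (N ≃ₐ[M] N) η q) =
          X + C ((O.subtype : O →+* N) ⟨_, hq⟩) := by
        rw [sub_eq_add_neg, ← C_neg]
        rfl
      rw [this]
      exact Subsemiring.add_mem _ (Polynomial.X_mem_lifts _) (Polynomial.C_mem_lifts _ _)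
    intro k
    obtain ⟨c, hc⟩ := (Polynomial.lifts_iff_coeff_lifts FN).mp hlift k
    rw [← hc]
    exact c.2
  have hcoeffM : ∀ k, ((FN.coeff k : N) : Ω) ∈ M := by
    intro k
    have hfix : ∀ g : N ≃ₐ[M] N, g (FN.coeff k) = FN.coeff k := fun g => by
      have h : g • FN.coeff k = FN.coeff k := by rw [← Polynomial.coeff_smul, hFNsmul]
      rwa [AlgEquiv.smul_def] at h
    obtain ⟨m, hm⟩ := (IntermediateField.mem_bot.mp ((IsGalois.mem_bot_iff_fixed _).mpr hfix))
    rw [← hm]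
    exact m.2
  let F : Polynomial Ω := FN.map (algebraMap N Ω)
  have hFcoeff : ∀ k, F.coeff k = ((FN.coeff k : N) : Ω) := fun k => Polynomial.coeff_map _ _
  have hFeval : F.eval (η : Ω) = 0 := by
    change (FN.map (algebraMap N Ω)).eval (algebraMap N Ω η) = 0
    rw [eval_map, eval₂_hom, hFNeval, map_zero]
  -- the derivative at `η`
  have hFder : V.valuation ((derivative F).eval (η : Ω)) = 1 := by
    let q₁ : (N ≃ₐ[M] N) ⧸ MulAction.stabilizer (N ≃ₐ[M] N) η := QuotientGroup.mk 1
    let B : N[X] := ∏ q ∈ Finset.univ.erase q₁,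
      (X - C (MulAction.ofQuotientStabilizer (N ≃ₐ[M] N) η q))
    have hsplit : FN = (X - C η) * B := by
      rw [hFN, ← Finset.mul_prod_erase Finset.univ _ (Finset.mem_univ q₁)]
      congr 2
    have hderN : (derivative FN).eval η = B.eval η := by
      rw [hsplit, derivative_mul, derivative_sub, derivative_X, derivative_C, sub_zero, one_mul,
        eval_add, eval_mul, eval_sub, eval_X, eval_C, sub_self, zero_mul, add_zero]
    have hder : (derivative F).eval (η : Ω) = algebraMap N Ω (B.eval η) := by
      change (derivative (FN.map (algebraMap N Ω))).eval (algebraMap N Ω η) = _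
      rw [derivative_map, eval_map, eval₂_hom, hderN]
    rw [hder, eval_prod]
    change V.valuation (((∏ q ∈ Finset.univ.erase q₁,
      (X - C (MulAction.ofQuotientStabilizer (N ≃ₐ[M] N) η q)).eval η : N) : Ω)) = 1
    push_cast
    refine ValuationSubring.valuation_prod_eq_one V _ _ fun q hq => ?_
    rw [eval_sub, eval_X, eval_C]
    obtain ⟨g, rfl⟩ := QuotientGroup.mk_surjective q
    have hgZ : g ∉ Z := by
      intro hgZ
      apply (Finset.mem_erase.mp hq).1
      change (QuotientGroup.mk g : (N ≃ₐ[M] N) ⧸ MulAction.stabilizer (N ≃ₐ[M] N) η) =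
        QuotientGroup.mk 1
      rw [QuotientGroup.eq, mul_one, hstab']
      exact Z.inv_mem hgZ
    rw [MulAction.ofQuotientStabilizer_mk, AlgEquiv.smul_def]
    push_cast
    exact valuation_sub_eq_one_of_sub_one_lt_of_lt V he (hf g hgZ)
  refine ⟨η, hηV, hstab, ⟨F, hFNmonic.map _, fun k => ?_, hFeval, hFder⟩, ?_⟩
  · rw [hFcoeff]
    exact ⟨hcoeffV k, hcoeffM k⟩
  · -- `N^{G_Z} = M(η)`
    apply le_antisymm
    · have h1 : (IntermediateField.adjoin M ({η} : Set N)).fixingSubgroup ≤ Z := by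
        intro σ hσ
        rw [← hstab σ]
        exact (IntermediateField.mem_fixingSubgroup_iff _ _).mp hσ η
          (IntermediateField.mem_adjoin_simple_self M η)
      intro x hx
      rw [← IsGalois.fixedField_fixingSubgroup (IntermediateField.adjoin M ({η} : Set N))]
      rw [IntermediateField.mem_fixedField_iff] at hx ⊢
      exact fun σ hσ => hx σ (h1 hσ)
    · exact IntermediateField.adjoin_le_iff.mpr (Set.singleton_subset_iff.mpr
        ((IntermediateField.mem_fixedField_iff _ _).mpr fun σ hσ => hd σ hσ))

end DecompositionField

/-! ### The inertia field is generated over the decomposition field by a henselian element -/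

section InertiaField

variable {Ω : Type u} [Field Ω] (V : ValuationSubring Ω) {M : Subfield Ω}
  (N : IntermediateField M Ω)

/-- **The residue map of `σ ∈ G_Z`**: an `Mv`-algebra endomorphism of the residue field
`Nv ⊆ Ωv` of `V ∩ N` sending the residue of `x ∈ N ∩ V` to the residue of `σ x` (well defined
because `σ ∈ G_Z` stabilizes `V ∩ N` and its maximal ideal; cf. `exists_residueAlgHom` of
`TameTowerInertiaField.lean`, which assumes `V` stable under the whole Galois group).
[cite: ZariskiSamuel1960, Ch. VI §12, p. 69 ("`s` induces an automorphism `s̄` of the residue field")] -/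
theorem exists_residueAlgHom_of_mem_decompositionGroupIn {σ : N ≃ₐ[M] N}
    (hσ : σ ∈ decompositionGroupIn V N) :
    ∃ ψ : Subfield.extendScalars (residueSubfield_base_le V N) →ₐ[residueSubfield M V]
        Subfield.extendScalars (residueSubfield_base_le V N),
      ∀ (x : N) (hx : (x : Ω) ∈ V),
        (ψ ⟨residue V ⟨x, hx⟩, residue_mem_residueSubfield_intermediateField V x hx⟩ :
            ResidueField V) =
          residue V ⟨(σ x : N), ((mem_decompositionGroupIn_iff V N σ).mp hσ x).mp hx⟩ := by
  classical
  have hV : ∀ x : N, (x : Ω) ∈ V → ((σ x : N) : Ω) ∈ V := fun x hx =>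
    ((mem_decompositionGroupIn_iff V N σ).mp hσ x).mp hx
  have hsub : ∀ x y : N, V.valuation ((x : Ω) - y) < 1 →
      V.valuation (((σ x : N) : Ω) - (σ y : N)) < 1 := fun x y h => by
    have h1 : V.valuation (((x - y : N)) : Ω) < 1 := by push_cast; exact h
    have h2 := (valuation_lt_one_iff_of_mem_decompositionGroupIn V N hσ (x - y)).mp h1
    rw [map_sub] at h2
    push_cast at h2
    exact h2
  -- choice of representatives
  have hrep : ∀ r : Subfield.extendScalars (residueSubfield_base_le V N),
      ∃ (x : N) (hx : (x : Ω) ∈ V), residue V ⟨x, hx⟩ = r := fun r =>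
    (mem_residueSubfield_intermediateField_iff V (r : ResidueField V)).mp r.2
  choose rep hrep_mem hrep_eq using hrep
  let f : Subfield.extendScalars (residueSubfield_base_le V N) →
      Subfield.extendScalars (residueSubfield_base_le V N) := fun r =>
    ⟨residue V ⟨(σ (rep r) : N), hV _ (hrep_mem r)⟩,
      residue_mem_residueSubfield_intermediateField V (σ (rep r)) _⟩
  -- `f` on residues
  have hf : ∀ (x : N) (hx : (x : Ω) ∈ V),
      f ⟨residue V ⟨x, hx⟩, residue_mem_residueSubfield_intermediateField V x hx⟩ =
        ⟨residue V ⟨(σ x : N), hV x hx⟩,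
          residue_mem_residueSubfield_intermediateField V (σ x) _⟩ := by
    intro x hx
    set r : Subfield.extendScalars (residueSubfield_base_le V N) :=
      ⟨residue V ⟨x, hx⟩, residue_mem_residueSubfield_intermediateField V x hx⟩
    have h1 : residue V ⟨(rep r : Ω), hrep_mem r⟩ = residue V ⟨x, hx⟩ := hrep_eq r
    rw [residue_mk_eq_iff] at h1
    apply Subtype.ext
    change residue V ⟨(σ (rep r) : N), _⟩ = residue V ⟨(σ x : N), _⟩
    rw [residue_mk_eq_iff]
    exact hsub _ _ h1
  -- every element of `Nv` is a residue
  have hsurj : ∀ r : Subfield.extendScalars (residueSubfield_base_le V N),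
      ∃ (x : N) (hx : (x : Ω) ∈ V),
        r = ⟨residue V ⟨x, hx⟩, residue_mem_residueSubfield_intermediateField V x hx⟩ :=
    fun r => ⟨rep r, hrep_mem r, Subtype.ext (hrep_eq r).symm⟩
  refine ⟨{ toFun := f
            map_one' := ?_
            map_mul' := ?_
            map_zero' := ?_
            map_add' := ?_
            commutes' := ?_ }, fun x hx => ?_⟩
  · have h1 : (1 : Subfield.extendScalars (residueSubfield_base_le V N)) =
        ⟨residue V ⟨((1 : N) : Ω), by push_cast; exact V.one_mem⟩,
          residue_mem_residueSubfield_intermediateField V 1 _⟩ :=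
      Subtype.ext (by push_cast; exact (map_one (residue V)).symm)
    rw [h1, hf]
    apply Subtype.ext
    change residue V ⟨((σ 1 : N) : Ω), _⟩ = 1
    have : (⟨((σ 1 : N) : Ω), hV 1 (by push_cast; exact V.one_mem)⟩ : V) = 1 :=
      Subtype.ext (by push_cast [map_one]; rfl)
    rw [this, map_one]
  · intro r s
    obtain ⟨x, hx, rfl⟩ := hsurj r
    obtain ⟨y, hy, rfl⟩ := hsurj s
    have hxy : ((x * y : N) : Ω) ∈ V := by push_cast; exact mul_mem hx hy
    have h1 : (⟨residue V ⟨x, hx⟩, residue_mem_residueSubfield_intermediateField V x hx⟩ *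
          ⟨residue V ⟨y, hy⟩, residue_mem_residueSubfield_intermediateField V y hy⟩ :
          Subfield.extendScalars (residueSubfield_base_le V N)) =
        ⟨residue V ⟨((x * y : N) : Ω), hxy⟩,
          residue_mem_residueSubfield_intermediateField V (x * y) hxy⟩ := by
      apply Subtype.ext
      change residue V ⟨x, hx⟩ * residue V ⟨y, hy⟩ = residue V ⟨((x * y : N) : Ω), hxy⟩
      rw [← map_mul]
      rfl
    rw [h1, hf, hf, hf]
    apply Subtype.ext
    change residue V ⟨((σ (x * y) : N) : Ω), _⟩ =
      residue V ⟨((σ x : N) : Ω), _⟩ * residue V ⟨((σ y : N) : Ω), _⟩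
    rw [← map_mul]
    exact congrArg (residue V) (Subtype.ext (by push_cast [map_mul]; rfl))
  · have h0 : (0 : Subfield.extendScalars (residueSubfield_base_le V N)) =
        ⟨residue V ⟨((0 : N) : Ω), by push_cast; exact V.zero_mem⟩,
          residue_mem_residueSubfield_intermediateField V 0 _⟩ :=
      Subtype.ext (by push_cast; exact (map_zero (residue V)).symm)
    rw [h0, hf]
    apply Subtype.ext
    change residue V ⟨((σ 0 : N) : Ω), _⟩ = 0
    have : (⟨((σ 0 : N) : Ω), hV 0 (by push_cast; exact V.zero_mem)⟩ : V) = 0 :=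
      Subtype.ext (by push_cast [map_zero]; rfl)
    rw [this, map_zero]
  · intro r s
    obtain ⟨x, hx, rfl⟩ := hsurj r
    obtain ⟨y, hy, rfl⟩ := hsurj s
    have hxy : ((x + y : N) : Ω) ∈ V := by push_cast; exact add_mem hx hy
    have h1 : (⟨residue V ⟨x, hx⟩, residue_mem_residueSubfield_intermediateField V x hx⟩ +
          ⟨residue V ⟨y, hy⟩, residue_mem_residueSubfield_intermediateField V y hy⟩ :
          Subfield.extendScalars (residueSubfield_base_le V N)) =
        ⟨residue V ⟨((x + y : N) : Ω), hxy⟩,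
          residue_mem_residueSubfield_intermediateField V (x + y) hxy⟩ := by
      apply Subtype.ext
      change residue V ⟨x, hx⟩ + residue V ⟨y, hy⟩ = residue V ⟨((x + y : N) : Ω), hxy⟩
      rw [← map_add]
      rfl
    rw [h1, hf, hf, hf]
    apply Subtype.ext
    change residue V ⟨((σ (x + y) : N) : Ω), _⟩ =
      residue V ⟨((σ x : N) : Ω), _⟩ + residue V ⟨((σ y : N) : Ω), _⟩
    rw [← map_add]
    exact congrArg (residue V) (Subtype.ext (by push_cast [map_add]; rfl))
  · intro c
    obtain ⟨d, hd, hdc⟩ := (mem_residueSubfield_subfield_iff V (c : ResidueField V)).mp c.2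
    have hdN : ((algebraMap M N d : N) : Ω) ∈ V := hd
    have h1 : (algebraMap (residueSubfield M V)
        (Subfield.extendScalars (residueSubfield_base_le V N)) c) =
        ⟨residue V ⟨((algebraMap M N d : N) : Ω), hdN⟩,
          residue_mem_residueSubfield_intermediateField V _ hdN⟩ := by
      apply Subtype.ext
      change (c : ResidueField V) = residue V ⟨((algebraMap M N d : N) : Ω), hdN⟩
      rw [← hdc]
      rfl
    rw [h1, hf]
    apply Subtype.ext
    change residue V ⟨((σ (algebraMap M N d) : N) : Ω), _⟩ =
      residue V ⟨((algebraMap M N d : N) : Ω), hdN⟩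
    congr 1
    apply Subtype.ext
    change ((σ (algebraMap M N d) : N) : Ω) = ((algebraMap M N d : N) : Ω)
    rw [AlgEquiv.commutes]
  · change (f _ : ResidueField V) = _
    rw [hf]

variable [FiniteDimensional M N]

/-- **An element of `V ∩ N` whose residue is moved by every `σ ∈ G_Z ∖ G_T`.** The residue
field `Nv` is a finite-dimensional `Mv`-vector space, and for `σ ∈ G_Z ∖ G_T` the residues fixed
by `σ̄` form a proper subspace; `Nv` is not the union of these finitely many proper subspaces
(over an infinite `Mv` by Mathlib's `Submodule.exists_forall_notMem_of_forall_ne_top`; over a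
finite `Mv` the field `Nv` is finite and a generator of `Nvˣ` is fixed by no `σ̄ ≠ 1`).
[folklore] -/
theorem exists_forall_not_valuation_sub_lt_one :
    ∃ y : N, (y : Ω) ∈ V ∧ ∀ σ ∈ decompositionGroupIn V N, σ ∉ inertiaGroupIn V N →
      ¬ V.valuation (((σ y : N) : Ω) - y) < 1 := by
  classical
  haveI : FiniteDimensional (residueSubfield M V)
      (Subfield.extendScalars (residueSubfield_base_le V N)) :=
    finiteDimensional_residueSubfield (V := V) (L := N)
  let Bad : Type u := {σ : N ≃ₐ[M] N // σ ∈ decompositionGroupIn V N ∧ σ ∉ inertiaGroupIn V N}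
  -- witnesses of non-inertia
  have hwit : ∀ b : Bad, ∃ (x : N) (hx : (x : Ω) ∈ V),
      ¬ V.valuation (((b.1 x : N) : Ω) - x) < 1 := by
    rintro ⟨σ, hσZ, hσT⟩
    by_contra h
    push Not at h
    exact hσT ((mem_inertiaGroupIn_iff V N σ).mpr
      ⟨(mem_decompositionGroupIn_iff V N σ).mp hσZ, fun x hx => h x hx⟩)
  -- residue maps of the bad automorphisms and their fixed subspaces
  have hψ : ∀ b : Bad, ∃ ψ : Subfield.extendScalars (residueSubfield_base_le V N)
      →ₐ[residueSubfield M V] Subfield.extendScalars (residueSubfield_base_le V N),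
      ∀ (x : N) (hx : (x : Ω) ∈ V),
        (ψ ⟨residue V ⟨x, hx⟩, residue_mem_residueSubfield_intermediateField V x hx⟩ :
            ResidueField V) =
          residue V ⟨(b.1 x : N), ((mem_decompositionGroupIn_iff V N b.1).mp b.2.1 x).mp hx⟩ :=
    fun b => exists_residueAlgHom_of_mem_decompositionGroupIn V N b.2.1
  choose ψ hψ using hψ
  let W : Bad → Submodule (residueSubfield M V)
      (Subfield.extendScalars (residueSubfield_base_le V N)) := fun b =>
    LinearMap.ker ((ψ b).toLinearMap - LinearMap.id)
  have hW : ∀ (b : Bad) (r : Subfield.extendScalars (residueSubfield_base_le V N)),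
      r ∈ W b ↔ ψ b r = r := fun b r => by
    change r ∈ LinearMap.ker ((ψ b).toLinearMap - LinearMap.id) ↔ _
    rw [LinearMap.mem_ker, LinearMap.sub_apply, sub_eq_zero]
    rfl
  -- residues being fixed by `σ̄` read on representatives
  have hfix_iff : ∀ (b : Bad) (x : N) (hx : (x : Ω) ∈ V),
      (⟨residue V ⟨x, hx⟩, residue_mem_residueSubfield_intermediateField V x hx⟩ :
          Subfield.extendScalars (residueSubfield_base_le V N)) ∈ W b ↔
        V.valuation (((b.1 x : N) : Ω) - x) < 1 := fun b x hx => by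
    rw [hW, ← residue_mk_eq_iff V (((mem_decompositionGroupIn_iff V N b.1).mp b.2.1 x).mp hx) hx,
      ← hψ b x hx]
    exact ⟨fun h => congrArg Subtype.val h, fun h => Subtype.ext h⟩
  -- each fixed subspace is proper
  have hWtop : ∀ b, W b ≠ ⊤ := by
    intro b htop
    obtain ⟨x, hx, hnot⟩ := hwit b
    apply hnot
    rw [← hfix_iff b x hx, htop]
    exact Submodule.mem_top
  -- avoidance
  have havoid : ∃ r : Subfield.extendScalars (residueSubfield_base_le V N), ∀ b, r ∉ W b := by
    by_cases hk : Finite (residueSubfield M V)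
    · -- finite residue field: a generator of the cyclic unit group
      haveI : Finite (Subfield.extendScalars (residueSubfield_base_le V N)) :=
        Module.finite_of_finite (residueSubfield M V)
      obtain ⟨g, hg⟩ := IsCyclic.exists_generator
        (α := (Subfield.extendScalars (residueSubfield_base_le V N))ˣ)
      refine ⟨(g : Subfield.extendScalars (residueSubfield_base_le V N)), fun b hb => hWtop b ?_⟩
      rw [hW] at hb
      rw [eq_top_iff]
      rintro r -
      rw [hW]
      by_cases hr : r = 0
      · rw [hr, map_zero]
      · obtain ⟨n, hn⟩ := Subgroup.mem_zpowers_iff.mp (hg (Units.mk0 r hr))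
        have hr' : r = ((g ^ n : (Subfield.extendScalars (residueSubfield_base_le V N))ˣ) :
            Subfield.extendScalars (residueSubfield_base_le V N)) := by
          rw [hn]
          rfl
        rw [hr', Units.val_zpow_eq_zpow_val, map_zpow₀, hb]
    · haveI : Infinite (residueSubfield M V) := not_finite_iff_infinite.mp hk
      exact Submodule.exists_forall_notMem_of_forall_ne_top W hWtop
  obtain ⟨r, hr⟩ := havoid
  obtain ⟨y, hy, hyr⟩ := (mem_residueSubfield_intermediateField_iff V (r : ResidueField V)).mp r.2
  refine ⟨y, hy, fun σ hσZ hσT hlt => hr ⟨σ, hσZ, hσT⟩ ?_⟩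
  have hr' : r = ⟨residue V ⟨y, hy⟩, residue_mem_residueSubfield_intermediateField V y hy⟩ :=
    Subtype.ext hyr.symm
  rw [hr', hfix_iff]
  exact hlt

/-- **An element of the inertia field whose residue is moved by every `σ ∈ G_Z ∖ G_T`.** From
`y` as in `exists_forall_not_valuation_sub_lt_one`: the polynomial `∏_{τ ∈ G_T} (X − τ y)` has
coefficients in `V ∩ N^{G_T}` and reduces to `(X − ȳ)^{|G_T|}`; writing `|G_T| = Q m` with `Q`
a power of the residue characteristic (`Q = 1` in residue characteristic `0`) and `m` prime to
it, its coefficient `η` of degree `Q(m − 1)` has residue `−m ȳ^Q`, and `σ η` has residue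
`−m σ̄(ȳ)^Q ≠ −m ȳ^Q` for `σ ∈ G_Z ∖ G_T` (the `Q`-th power map is injective). [folklore] -/
theorem exists_mem_fixedField_inertiaGroupIn_forall_not_lt :
    ∃ η : N, (η : Ω) ∈ V ∧ η ∈ fixedField (inertiaGroupIn V N) ∧
      ∀ σ ∈ decompositionGroupIn V N, σ ∉ inertiaGroupIn V N →
        ¬ V.valuation (((σ η : N) : Ω) - η) < 1 := by
  classical
  obtain ⟨y, hy, hbad⟩ := exists_forall_not_valuation_sub_lt_one V N
  haveI : Fintype ↥(inertiaGroupIn V N) := Fintype.ofFinite _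
  -- stability under `G_Z`, inertia of `G_T`
  have hZV : ∀ σ ∈ decompositionGroupIn V N, ∀ x : N, (x : Ω) ∈ V → ((σ x : N) : Ω) ∈ V :=
    fun σ hσ x hx => ((mem_decompositionGroupIn_iff V N σ).mp hσ x).mp hx
  have hZlt : ∀ σ ∈ decompositionGroupIn V N, ∀ x : N,
      V.valuation (x : Ω) < 1 → V.valuation ((σ x : N) : Ω) < 1 :=
    fun σ hσ x => (valuation_lt_one_iff_of_mem_decompositionGroupIn V N hσ x).mp
  have hTZ : inertiaGroupIn V N ≤ decompositionGroupIn V N :=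
    inertiaGroupIn_le_decompositionGroupIn V N
  have hTy : ∀ τ ∈ inertiaGroupIn V N, V.valuation (((τ y : N) : Ω) - y) < 1 :=
    fun τ hτ => ((mem_inertiaGroupIn_iff V N τ).mp hτ).2 y hy
  -- `|G_T| = Q m`, `Q` a power of the residue characteristic exponent, `m` a residue unit
  obtain ⟨Q, m, hQ, hcard, hm0, hfrob, hfrobX⟩ : ∃ Q m : ℕ, 0 < Q ∧
      Fintype.card ↥(inertiaGroupIn V N) = Q * m ∧ (m : ResidueField V) ≠ 0 ∧
      (∀ x z : ResidueField V, (x - z) ^ Q = x ^ Q - z ^ Q) ∧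
      (∀ f g : (ResidueField V)[X], (f - g) ^ Q = f ^ Q - g ^ Q) := by
    let p := ringChar (ResidueField V)
    haveI hp : CharP (ResidueField V) p := ringChar.charP _
    rcases CharP.char_is_prime_or_zero (ResidueField V) p with hprime | hzero
    · haveI : Fact p.Prime := ⟨hprime⟩
      obtain ⟨a, m, hm, hcard⟩ :=
        Nat.exists_eq_pow_mul_and_not_dvd (Fintype.card_ne_zero (α := ↥(inertiaGroupIn V N)))
          p hprime.ne_one
      refine ⟨p ^ a, m, pow_pos hprime.pos a, hcard, ?_, fun x z => sub_pow_char_pow x z a,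
        fun f g => sub_pow_char_pow f g a⟩
      rw [Ne, CharP.cast_eq_zero_iff (ResidueField V) p]
      exact hm
    · haveI : CharP (ResidueField V) 0 := hzero ▸ hp
      haveI : CharZero (ResidueField V) := CharP.charP_to_charZero (ResidueField V)
      exact ⟨1, Fintype.card ↥(inertiaGroupIn V N), one_pos, (one_mul _).symm,
        Nat.cast_ne_zero.mpr Fintype.card_ne_zero, fun x z => by simp, fun f g => by simp⟩
  have hm1 : 1 ≤ m := by
    rcases Nat.eq_zero_or_pos m with h | h
    · exact absurd (by rw [h, Nat.cast_zero]) hm0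
    · exact h
  -- the polynomial `∏_{τ ∈ G_T} (X − τ y)` over `N`
  let PN : N[X] := ∏ τ : ↥(inertiaGroupIn V N), (X - C ((τ : N ≃ₐ[M] N) y))
  have hPN : PN = ∏ τ : ↥(inertiaGroupIn V N), (X - C ((τ : N ≃ₐ[M] N) y)) := rfl
  -- it is fixed by `G_T`
  have hPNsmul : ∀ ρ : ↥(inertiaGroupIn V N), (ρ : N ≃ₐ[M] N) • PN = PN := fun ρ => by
    rw [hPN, Finset.smul_prod']
    simp only [smul_sub, Polynomial.smul_X, Polynomial.smul_C, AlgEquiv.smul_def]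
    exact Fintype.prod_equiv (Equiv.mulLeft ρ)
      (fun τ : ↥(inertiaGroupIn V N) => X - C ((ρ : N ≃ₐ[M] N) ((τ : N ≃ₐ[M] N) y)))
      (fun τ : ↥(inertiaGroupIn V N) => X - C ((τ : N ≃ₐ[M] N) y)) (fun τ => rfl)
  have hPNfix : ∀ k, PN.coeff k ∈ fixedField (inertiaGroupIn V N) := fun k =>
    (IntermediateField.mem_fixedField_iff _ _).mpr fun ρ hρ => by
      have h := congrArg (fun f : N[X] => f.coeff k) (hPNsmul ⟨ρ, hρ⟩)
      simp only [Polynomial.coeff_smul, AlgEquiv.smul_def] at h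
      exact h
  -- the key computation: for `σ ∈ G_Z`, `σ(PN.coeff k₀)` has residue `−m σ̄(ȳ)^Q`
  let k₀ : ℕ := (m - 1) * Q
  have key : ∀ (σ : N ≃ₐ[M] N) (hσ : σ ∈ decompositionGroupIn V N),
      ∃ hσV : ((σ (PN.coeff k₀) : N) : Ω) ∈ V,
        residue V ⟨_, hσV⟩ = -((residue V ⟨((σ y : N) : Ω), hZV σ hσ y hy⟩) ^ Q * m) := by
    intro σ hσ
    -- `σ • PN = ∏ (X − C (σ τ y))`, lifted to `V[X]`
    have hmem : ∀ τ : ↥(inertiaGroupIn V N), ((σ ((τ : N ≃ₐ[M] N) y) : N) : Ω) ∈ V := fun τ =>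
      hZV σ hσ _ (hZV τ (hTZ τ.2) y hy)
    let PV : (↥V)[X] := ∏ τ : ↥(inertiaGroupIn V N), (X - C (⟨_, hmem τ⟩ : V))
    have hσPN : σ • PN = ∏ τ : ↥(inertiaGroupIn V N), (X - C (σ ((τ : N ≃ₐ[M] N) y))) := by
      rw [hPN, Finset.smul_prod']
      simp only [smul_sub, Polynomial.smul_X, Polynomial.smul_C, AlgEquiv.smul_def]
    have hmapΩ : (σ • PN).map (algebraMap N Ω) = PV.map V.subtype := by
      rw [hσPN, Polynomial.map_prod, Polynomial.map_prod]
      refine Finset.prod_congr rfl fun τ _ => ?_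
      rw [Polynomial.map_sub, Polynomial.map_sub, map_X, map_X, map_C, map_C]
      rfl
    have hcoeffΩ : ((σ (PN.coeff k₀) : N) : Ω) = ((PV.coeff k₀ : V) : Ω) := by
      have h := congrArg (fun f : Polynomial Ω => f.coeff k₀) hmapΩ
      simp only [Polynomial.coeff_map] at h
      rw [Polynomial.coeff_smul, AlgEquiv.smul_def] at h
      exact h
    have hσV : ((σ (PN.coeff k₀) : N) : Ω) ∈ V := by rw [hcoeffΩ]; exact (PV.coeff k₀).2
    refine ⟨hσV, ?_⟩
    -- residues: `PV ↦ (X − C (res σy))^{Q m}`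
    have hres_factor : ∀ τ : ↥(inertiaGroupIn V N),
        residue V ⟨_, hmem τ⟩ = residue V ⟨((σ y : N) : Ω), hZV σ hσ y hy⟩ := fun τ => by
      rw [residue_mk_eq_iff]
      have h1 : V.valuation ((((τ : N ≃ₐ[M] N) y - y : N)) : Ω) < 1 := by
        push_cast
        exact hTy τ τ.2
      have h2 := hZlt σ hσ _ h1
      rw [map_sub] at h2
      push_cast at h2
      exact h2
    have hres : PV.map (residue V) =
        (X - C (residue V ⟨((σ y : N) : Ω), hZV σ hσ y hy⟩)) ^ (Q * m) := by
      rw [← hcard, Polynomial.map_prod]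
      simp only [Polynomial.map_sub, map_X, map_C]
      rw [Finset.prod_congr rfl fun τ _ => by rw [hres_factor τ], Finset.prod_const,
        Finset.card_univ]
    -- the coefficient of degree `Q (m − 1)`
    set c : ResidueField V := residue V ⟨((σ y : N) : Ω), hZV σ hσ y hy⟩ with hcdef
    have hexp : (X - C c) ^ (Q * m) = expand (ResidueField V) Q ((X - C (c ^ Q)) ^ m) := by
      rw [pow_mul, hfrobX, map_pow (expand (ResidueField V) Q),
        map_sub (expand (ResidueField V) Q), expand_X, expand_C, ← C_pow]
    have hcoeffres : ((X - C c) ^ (Q * m)).coeff k₀ = -(c ^ Q * m) := by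
      change ((X - C c) ^ (Q * m)).coeff ((m - 1) * Q) = _
      rw [hexp, coeff_expand_mul hQ, sub_eq_add_neg, ← C_neg, coeff_X_add_C_pow,
        Nat.sub_sub_self hm1, pow_one, Nat.choose_symm hm1, Nat.choose_one_right]
      ring
    have hresk : residue V (PV.coeff k₀) = -(c ^ Q * m) := by
      rw [← hcoeffres, ← hres, Polynomial.coeff_map]
    have heq : (⟨_, hσV⟩ : V) = PV.coeff k₀ := Subtype.ext hcoeffΩ
    rw [heq, hresk]
  -- `η := PN.coeff k₀`
  refine ⟨PN.coeff k₀, ?_, hPNfix k₀, fun σ hσZ hσT hlt => ?_⟩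
  · obtain ⟨h1V, -⟩ := key 1 (decompositionGroupIn V N).one_mem
    exact h1V
  · obtain ⟨hσV, hσres⟩ := key σ hσZ
    obtain ⟨h1V, h1res⟩ := key 1 (decompositionGroupIn V N).one_mem
    have h1V' : ((PN.coeff k₀ : N) : Ω) ∈ V := h1V
    have hy1 : (((1 : N ≃ₐ[M] N) y : N) : Ω) ∈ V := hy
    have e1 : (⟨(((1 : N ≃ₐ[M] N) (PN.coeff k₀) : N) : Ω), h1V⟩ : V) = ⟨_, h1V'⟩ := Subtype.ext rfl
    have e2 : (⟨(((1 : N ≃ₐ[M] N) y : N) : Ω), hZV 1 (decompositionGroupIn V N).one_mem y hy⟩ : V) =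
        ⟨(y : Ω), hy⟩ := Subtype.ext rfl
    rw [e1, e2] at h1res
    -- equal residues
    have hreseq : residue V ⟨_, hσV⟩ = residue V ⟨_, h1V'⟩ :=
      (residue_mk_eq_iff V hσV h1V').mpr hlt
    rw [hσres, h1res, neg_inj] at hreseq
    have hpow : (residue V ⟨((σ y : N) : Ω), hZV σ hσZ y hy⟩) ^ Q = (residue V ⟨(y : Ω), hy⟩) ^ Q :=
      mul_right_cancel₀ hm0 hreseq
    have hsub : (residue V ⟨((σ y : N) : Ω), hZV σ hσZ y hy⟩ - residue V ⟨(y : Ω), hy⟩) ^ Q = 0 := by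
      rw [hfrob, hpow, sub_self]
    have heqres : residue V ⟨((σ y : N) : Ω), hZV σ hσZ y hy⟩ = residue V ⟨(y : Ω), hy⟩ :=
      sub_eq_zero.mp (pow_eq_zero_iff hQ.ne' |>.mp hsub)
    exact hbad σ hσZ hσT ((residue_mk_eq_iff V _ hy).mp heqres)

variable {V N} in
omit [FiniteDimensional M N] in
/-- Bookkeeping: if `K₂ = K₁(η)` inside `N`, then, as subfields of `Ω`, `K₂ = K₁(η)` with `K₁`
read in `Ω`. [folklore] -/
theorem toSubfield_lift_eq_of_eq_sup_adjoin {K₁ K₂ : IntermediateField M N} {η : N}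
    (h : K₂ = K₁ ⊔ IntermediateField.adjoin M ({η} : Set N)) :
    (lift K₂).toSubfield =
      (IntermediateField.adjoin (lift K₁).toSubfield ({(η : Ω)} : Set Ω)).toSubfield := by
  have hK₁₂ : K₁ ≤ K₂ := h ▸ le_sup_left
  have hηK₂ : η ∈ K₂ := h ▸ (le_sup_right (a := K₁)) (IntermediateField.mem_adjoin_simple_self M η)
  apply le_antisymm
  · intro x hx
    have hxN : x ∈ N := IntermediateField.lift_le K₂ hx
    have hx' : (⟨x, hxN⟩ : N) ∈ K₂ := (IntermediateField.mem_lift (⟨x, hxN⟩ : N)).mp hx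
    -- the elements of `N` lying in `K₁(η) ⊆ Ω` form an intermediate field containing `K₁` and `η`
    let S : Subfield Ω :=
      (IntermediateField.adjoin (lift K₁).toSubfield ({(η : Ω)} : Set Ω)).toSubfield
    have hSK₁ : ∀ z : Ω, z ∈ lift K₁ → z ∈ S := fun z hz =>
      (IntermediateField.adjoin (lift K₁).toSubfield ({(η : Ω)} : Set Ω)).algebraMap_mem
        ⟨z, hz⟩
    let K' : IntermediateField M N :=
      (S.comap (algebraMap N Ω)).toIntermediateField fun m => by
        change ((algebraMap M N m : N) : Ω) ∈ S
        exact hSK₁ _ ((lift K₁).algebraMap_mem m)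
    have hK₁K' : K₁ ≤ K' := fun z hz => by
      change ((z : N) : Ω) ∈ S
      exact hSK₁ _ ((IntermediateField.mem_lift z).mpr hz)
    have hηK' : η ∈ K' := by
      change ((η : N) : Ω) ∈ S
      exact IntermediateField.subset_adjoin _ _ (Set.mem_singleton _)
    have hK₂K' : K₂ ≤ K' := by
      rw [h]
      exact sup_le hK₁K' (IntermediateField.adjoin_le_iff.mpr (Set.singleton_subset_iff.mpr hηK'))
    exact hK₂K' hx'
  · rw [IntermediateField.adjoin_toSubfield]
    refine Subfield.closure_le.mpr ?_
    rintro z (⟨w, rfl⟩ | hz)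
    · have hwN : (w : Ω) ∈ N := IntermediateField.lift_le K₁ w.2
      have hw' : (⟨(w : Ω), hwN⟩ : N) ∈ K₁ := (IntermediateField.mem_lift (⟨(w : Ω), hwN⟩ : N)).mp w.2
      exact (IntermediateField.mem_lift (⟨(w : Ω), hwN⟩ : N)).mpr (hK₁₂ hw')
    · rw [Set.mem_singleton_iff.mp hz]
      exact (IntermediateField.mem_lift η).mpr hηK₂

/-- **The inertia field of a valuation in a finite Galois extension is generated over the
decomposition field by a henselian element**: there is `η ∈ V ∩ N^{G_T}`, fixed by exactly
`G_T` among the elements of `G_Z`, root of a monic `F` with coefficients in `V ∩ N^{G_Z}` and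
`F'(η)` a unit of `V`, and `N^{G_T} = N^{G_Z}(η)`.
[cite: ZariskiSamuel1960, Ch. VI §12 (inertia group and field); folklore (Kuhlmann: subextensions of the absolute inertia field are generated by henselian elements)] -/
theorem exists_henselRoot_adjoin_eq_inertiaField [IsGalois M N] :
    ∃ η : N, (η : Ω) ∈ V ∧ η ∈ fixedField (inertiaGroupIn V N) ∧
      (∀ σ ∈ decompositionGroupIn V N, σ η = η ↔ σ ∈ inertiaGroupIn V N) ∧
      (∃ F : Polynomial Ω, F.Monic ∧
        (∀ k, F.coeff k ∈ V ∧ F.coeff k ∈ lift (fixedField (decompositionGroupIn V N))) ∧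
        F.eval (η : Ω) = 0 ∧ V.valuation ((derivative F).eval (η : Ω)) = 1) ∧
      fixedField (inertiaGroupIn V N) =
        fixedField (decompositionGroupIn V N) ⊔ IntermediateField.adjoin M ({η} : Set N) := by
  classical
  obtain ⟨η, hηV, hηT, hmoved⟩ := exists_mem_fixedField_inertiaGroupIn_forall_not_lt V N
  have hZV : ∀ σ ∈ decompositionGroupIn V N, ∀ x : N, (x : Ω) ∈ V → ((σ x : N) : Ω) ∈ V :=
    fun σ hσ x hx => ((mem_decompositionGroupIn_iff V N σ).mp hσ x).mp hx
  have hTZ : inertiaGroupIn V N ≤ decompositionGroupIn V N :=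
    inertiaGroupIn_le_decompositionGroupIn V N
  have hTfix : ∀ τ ∈ inertiaGroupIn V N, τ η = η := fun τ hτ =>
    (IntermediateField.mem_fixedField_iff _ _).mp hηT τ hτ
  have hstab : ∀ σ ∈ decompositionGroupIn V N, σ η = η ↔ σ ∈ inertiaGroupIn V N :=
    fun σ hσ => ⟨fun h => by
      by_contra hT
      refine hmoved σ hσ hT ?_
      rw [h, sub_self, map_zero]
      exact zero_lt_one, hTfix σ⟩
  -- the group `G_Z` acting on `N`; the stabilizer of `η` in it is `G_T`
  haveI : Fintype ↥(decompositionGroupIn V N) := Fintype.ofFinite _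
  have hstabZ : ∀ ζ : ↥(decompositionGroupIn V N),
      ζ ∈ MulAction.stabilizer ↥(decompositionGroupIn V N) η ↔
        (ζ : N ≃ₐ[M] N) ∈ inertiaGroupIn V N := fun ζ => by
    rw [MulAction.mem_stabilizer_iff, Subgroup.smul_def, AlgEquiv.smul_def, hstab _ ζ.2]
  -- `F := ∏_{q ∈ G_Z/G_T} (X − q η)`
  let FN : N[X] := ∏ q : ↥(decompositionGroupIn V N) ⧸
      MulAction.stabilizer ↥(decompositionGroupIn V N) η,
    (X - C (MulAction.ofQuotientStabilizer ↥(decompositionGroupIn V N) η q))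
  have hFN : FN = ∏ q : ↥(decompositionGroupIn V N) ⧸
      MulAction.stabilizer ↥(decompositionGroupIn V N) η,
    (X - C (MulAction.ofQuotientStabilizer ↥(decompositionGroupIn V N) η q)) := rfl
  have hFNsmul : ∀ g : ↥(decompositionGroupIn V N), g • FN = FN := fun g => by
    rw [hFN, Finset.smul_prod']
    exact Fintype.prod_bijective _ (MulAction.bijective g) _ _ fun q => by
      rw [MulAction.ofQuotientStabilizer_smul, smul_sub, Polynomial.smul_X, Polynomial.smul_C]
  have hFNmonic : FN.Monic := monic_prod_of_monic _ _ fun _ _ => monic_X_sub_C _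
  have hFNeval : FN.eval η = 0 := by
    rw [hFN, eval_prod]
    refine Finset.prod_eq_zero (Finset.mem_univ (QuotientGroup.mk 1 :
      ↥(decompositionGroupIn V N) ⧸ MulAction.stabilizer ↥(decompositionGroupIn V N) η)) ?_
    rw [MulAction.ofQuotientStabilizer_mk, one_smul, eval_sub, eval_X, eval_C, sub_self]
  have hroots : ∀ q : ↥(decompositionGroupIn V N) ⧸
      MulAction.stabilizer ↥(decompositionGroupIn V N) η,
      ((MulAction.ofQuotientStabilizer ↥(decompositionGroupIn V N) η q : N) : Ω) ∈ V := by
    intro q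
    obtain ⟨g, rfl⟩ := QuotientGroup.mk_surjective q
    rw [MulAction.ofQuotientStabilizer_mk, Subgroup.smul_def, AlgEquiv.smul_def]
    exact hZV _ g.2 η hηV
  have hcoeffV : ∀ k, ((FN.coeff k : N) : Ω) ∈ V := by
    have hlift : FN ∈ Polynomial.lifts
        ((V.comap (algebraMap N Ω)).subtype : V.comap (algebraMap N Ω) →+* N) := by
      rw [hFN]
      refine Subsemiring.prod_mem _ fun q _ => ?_
      have hq : (-(MulAction.ofQuotientStabilizer ↥(decompositionGroupIn V N) η q) : N) ∈
          V.comap (algebraMap N Ω) := (V.comap (algebraMap N Ω)).neg_mem _ (hroots q)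
      have : X - C (MulAction.ofQuotientStabilizer ↥(decompositionGroupIn V N) η q) =
          X + C (((V.comap (algebraMap N Ω)).subtype : V.comap (algebraMap N Ω) →+* N)
            ⟨_, hq⟩) := by
        rw [sub_eq_add_neg, ← C_neg]
        rfl
      rw [this]
      exact Subsemiring.add_mem _ (Polynomial.X_mem_lifts _) (Polynomial.C_mem_lifts _ _)
    intro k
    obtain ⟨c, hc⟩ := (Polynomial.lifts_iff_coeff_lifts FN).mp hlift k
    rw [← hc]
    exact c.2
  have hcoeffZ : ∀ k, FN.coeff k ∈ fixedField (decompositionGroupIn V N) := fun k =>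
    (IntermediateField.mem_fixedField_iff _ _).mpr fun σ hσ => by
      have h : (⟨σ, hσ⟩ : ↥(decompositionGroupIn V N)) • FN.coeff k = FN.coeff k := by
        rw [← Polynomial.coeff_smul, hFNsmul]
      rwa [Subgroup.smul_def, AlgEquiv.smul_def] at h
  let F : Polynomial Ω := FN.map (algebraMap N Ω)
  have hFcoeff : ∀ k, F.coeff k = ((FN.coeff k : N) : Ω) := fun k => Polynomial.coeff_map _ _
  have hFeval : F.eval (η : Ω) = 0 := by
    change (FN.map (algebraMap N Ω)).eval (algebraMap N Ω η) = 0
    rw [eval_map, eval₂_hom, hFNeval, map_zero]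
  have hFder : V.valuation ((derivative F).eval (η : Ω)) = 1 := by
    let q₁ : ↥(decompositionGroupIn V N) ⧸ MulAction.stabilizer ↥(decompositionGroupIn V N) η :=
      QuotientGroup.mk 1
    let B : N[X] := ∏ q ∈ Finset.univ.erase q₁,
      (X - C (MulAction.ofQuotientStabilizer ↥(decompositionGroupIn V N) η q))
    have hsplit : FN = (X - C η) * B := by
      rw [hFN, ← Finset.mul_prod_erase Finset.univ _ (Finset.mem_univ q₁)]
      congr 2
    have hderN : (derivative FN).eval η = B.eval η := by
      rw [hsplit, derivative_mul, derivative_sub, derivative_X, derivative_C, sub_zero, one_mul,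
        eval_add, eval_mul, eval_sub, eval_X, eval_C, sub_self, zero_mul, add_zero]
    have hder : (derivative F).eval (η : Ω) = algebraMap N Ω (B.eval η) := by
      change (derivative (FN.map (algebraMap N Ω))).eval (algebraMap N Ω η) = _
      rw [derivative_map, eval_map, eval₂_hom, hderN]
    rw [hder, eval_prod]
    change V.valuation (((∏ q ∈ Finset.univ.erase q₁,
      (X - C (MulAction.ofQuotientStabilizer ↥(decompositionGroupIn V N) η q)).eval η : N) :
        Ω)) = 1
    push_cast
    refine ValuationSubring.valuation_prod_eq_one V _ _ fun q hq => ?_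
    rw [eval_sub, eval_X, eval_C]
    obtain ⟨g, rfl⟩ := QuotientGroup.mk_surjective q
    have hgT : (g : N ≃ₐ[M] N) ∉ inertiaGroupIn V N := by
      intro hgT
      apply (Finset.mem_erase.mp hq).1
      change (QuotientGroup.mk g : ↥(decompositionGroupIn V N) ⧸
          MulAction.stabilizer ↥(decompositionGroupIn V N) η) = QuotientGroup.mk 1
      rw [QuotientGroup.eq, mul_one, hstabZ]
      exact (inertiaGroupIn V N).inv_mem hgT
    rw [MulAction.ofQuotientStabilizer_mk, Subgroup.smul_def, AlgEquiv.smul_def]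
    push_cast
    -- `v(η − g η) = 1`
    have hgV : (((g : N ≃ₐ[M] N) η : N) : Ω) ∈ V := hZV _ g.2 η hηV
    have hle : V.valuation ((η : Ω) - ((g : N ≃ₐ[M] N) η : N)) ≤ 1 :=
      (V.valuation_le_one_iff _).mpr (V.sub_mem hηV hgV)
    have hnlt : ¬ V.valuation ((η : Ω) - ((g : N ≃ₐ[M] N) η : N)) < 1 := fun hlt => by
      apply hmoved _ g.2 hgT
      rw [← Valuation.map_neg, neg_sub]
      exact hlt
    exact le_antisymm hle (not_lt.mp hnlt)
  refine ⟨η, hηV, hηT, hstab, ⟨F, hFNmonic.map _, fun k => ?_, hFeval, hFder⟩, ?_⟩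
  · rw [hFcoeff]
    exact ⟨hcoeffV k, (IntermediateField.mem_lift (FN.coeff k)).mpr (hcoeffZ k)⟩
  · -- `N^{G_T} = N^{G_Z}(η)` by the Galois correspondence
    have hfix : (fixedField (decompositionGroupIn V N) ⊔
        IntermediateField.adjoin M ({η} : Set N)).fixingSubgroup = inertiaGroupIn V N := by
      rw [IntermediateField.fixingSubgroup_sup, IntermediateField.fixingSubgroup_fixedField]
      ext σ
      constructor
      · rintro ⟨hσZ, hσA⟩
        rw [← hstab σ hσZ]
        exact (IntermediateField.mem_fixingSubgroup_iff _ _).mp hσA η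
          (IntermediateField.mem_adjoin_simple_self M η)
      · intro hσT
        refine ⟨hTZ hσT, (IntermediateField.mem_fixingSubgroup_iff _ _).mpr fun x hx => ?_⟩
        have hle : IntermediateField.adjoin M ({η} : Set N) ≤ fixedField (inertiaGroupIn V N) :=
          IntermediateField.adjoin_le_iff.mpr (Set.singleton_subset_iff.mpr hηT)
        exact (IntermediateField.mem_fixedField_iff _ _).mp (hle hx) σ hσT
    calc fixedField (inertiaGroupIn V N)
        = fixedField ((fixedField (decompositionGroupIn V N) ⊔
            IntermediateField.adjoin M ({η} : Set N)).fixingSubgroup) := by rw [hfix]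
      _ = _ := IsGalois.fixedField_fixingSubgroup _

/-- The same, read in `Ω`: `N^{G_T} = N^{G_Z}(η)` as subfields of `Ω`, `η` a henselian element over
`V ∩ N^{G_Z}` (the shape consumed by the étale climb of `ArithmeticalThreefoldsLocalEtaleClimb.lean`
with base subfield `N^{G_Z} ⊆ Ω`). [folklore] -/
theorem exists_henselRoot_toSubfield_inertiaField_eq [IsGalois M N] :
    ∃ η : Ω, η ∈ V ∧ η ∈ lift (fixedField (inertiaGroupIn V N)) ∧
      (∃ F : Polynomial Ω, F.Monic ∧
        (∀ k, F.coeff k ∈ V ∧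
          F.coeff k ∈ (lift (fixedField (decompositionGroupIn V N))).toSubfield) ∧
        F.eval η = 0 ∧ V.valuation ((derivative F).eval η) = 1) ∧
      (lift (fixedField (inertiaGroupIn V N))).toSubfield =
        (IntermediateField.adjoin (lift (fixedField (decompositionGroupIn V N))).toSubfield
          ({η} : Set Ω)).toSubfield := by
  obtain ⟨η, hηV, hηT, -, ⟨F, hFmon, hFcoeff, hFeval, hFder⟩, hfield⟩ :=
    exists_henselRoot_adjoin_eq_inertiaField V N
  exact ⟨η, hηV, (IntermediateField.mem_lift η).mpr hηT, ⟨F, hFmon, hFcoeff, hFeval, hFder⟩,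
    toSubfield_lift_eq_of_eq_sup_adjoin hfield⟩

/-- The same for the decomposition field, read in `Ω`: `N^{G_Z} = M(η)` as subfields of `Ω`,
`η` a henselian element over `V ∩ M`. [folklore] -/
theorem exists_henselRoot_toSubfield_decompositionField_eq [IsGalois M N] :
    ∃ η : Ω, η ∈ V ∧ η ∈ lift (fixedField (decompositionGroupIn V N)) ∧
      (∃ F : Polynomial Ω, F.Monic ∧ (∀ k, F.coeff k ∈ V ∧ F.coeff k ∈ M) ∧
        F.eval η = 0 ∧ V.valuation ((derivative F).eval η) = 1) ∧
      (lift (fixedField (decompositionGroupIn V N))).toSubfield =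
        (IntermediateField.adjoin M ({η} : Set Ω)).toSubfield := by
  obtain ⟨η, hηV, hstab, hF, hfield⟩ := exists_henselRoot_adjoin_eq_decompositionField V N
  refine ⟨η, hηV, (IntermediateField.mem_lift η).mpr ?_, hF, ?_⟩
  · rw [hfield]
    exact IntermediateField.mem_adjoin_simple_self M η
  · rw [hfield, IntermediateField.lift_adjoin_simple]

end InertiaField

end Literature.AlgebraicGeometry.Resolution

end
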